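import Literature.Computability.QuantumComplexity.QuadraticFourierSampler
import Literature.Computability.QuantumComplexity.QuadraticPolarForm
import Literature.Computability.QuantumComplexity.ForrelationDerivativeTables
import Literature.Computability.QuantumComplexity.ForrelationCircuitCode
import HarnessLib

/-!
# Exact Fourier sampling of quadratic phase functions, II: correctness of the sampler

Topic `Literature/Computability/QuantumComplexity`; the analysis of `QuadraticFourierSampler.lean`.
For a QUADRATIC `q : {0,1}ⁿ → {0,1}` (`toZFun q ∈ CHHL2018.lowDeg n 2`, e.g. the derivative of a
cubic) handed over as the list oracle `liftQ q`, with Walsh coefficients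
`W(u) = Σ_x (-1)^{q(x)} (-1)^{u·x}`:

* `toZ_bentry` — the machine's matrix IS the polar form `B_q(eᵢ, eⱼ)` (`QuadraticPolarForm.lean`),
  the radical `{d | B_q(·, d) = 0}` is the kernel of the matrix (`Bd_eq_zero_iff`);
* **Dickson's theorem, support form** (`walsh_sq_eq`): `W(u)² = 2ⁿ · |rad| · [u ⊕ u⋆ ⊥ rad]`, where
  the machine's `u⋆ = ustarOf …` satisfies `u⋆ · d = q(d) ⊕ q(0)` on the radical (`ell_eq_dot_ustar`);
* **the sampler is exact** (`card_fiber_mul_two_pow_eq_walsh_sq`): for every `u`,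
  `#{w ∈ {0,1}ⁿ : uOf (liftQ q) n w = u} · 2ⁿ = W(u)²` — a uniformly random `w` yields `u` with
  probability `W(u)²/4ⁿ`, the Fourier distribution of the phase state `(-1)^q`.

All statements are proved (K1–K3 of `F2RowReduction.lean`; polar forms of `QuadraticPolarForm.lean`).

## References

* F. J. MacWilliams, N. J. A. Sloane, *The Theory of Error-Correcting Codes*, 1977, Ch. 15 §2,
  Thm 4–5 (Dickson: Walsh/weight distribution of quadratic forms via the rank of the symplectic
  form). [MacWilliamsSloane1977]
* C. Carlet, *Boolean Functions for Cryptography and Coding Theory*, CUP 2020, §5.2 (the Walsh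
  support of a quadratic function is a flat of the orthogonal of the kernel of its symplectic form,
  with constant amplitude). [Carlet2020]
-/

noncomputable section

namespace Literature.Computability.QuantumComplexity

namespace QuadSampler

open Finset Literature.Computability.Complexity Literature.Computability.Complexity.F2Elim QuadPolar CHHL2018
open Literature.Computability.Complexity.LowDegree (xorVec xorVec_apply xorVec_xorVec_cancel)
open Literature.Computability.Complexity.BLR (toZ toZ_xor toZ_injective)
open ForrCode (toInput)

variable {n : ℕ}

/-! ### Bridges: bit vectors, `𝔽₂`-vectors, signs -/

/-- A bit vector as an `𝔽₂`-vector. [folklore] -/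
def bz (x : Fin n → Bool) : Fin n → ZMod 2 := fun i => toZ (x i)

/-- Entries of `bz`. [folklore] -/
@[simp] theorem bz_apply (x : Fin n → Bool) (i : Fin n) : bz x i = toZ (x i) := rfl

/-- `bz` is additive. [folklore] -/
theorem bz_xorVec (x y : Fin n → Bool) : bz (xorVec x y) = bz x + bz y := by
  funext i; simp [toZ_xor]

/-- The zero vector. [folklore] -/
def zeroV : Fin n → Bool := fun _ => false

/-- `bz 0 = 0`. [folklore] -/
@[simp] theorem bz_zeroV : bz (zeroV : Fin n → Bool) = 0 := by
  funext i; simp [zeroV, Literature.Computability.Complexity.BLR.toZ]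

/-- `bz` is injective. [folklore] -/
theorem bz_injective : Function.Injective (bz : (Fin n → Bool) → Fin n → ZMod 2) := fun x y h => by
  funext i; exact toZ_injective (congrFun h i)

/-- The bit vector of an `𝔽₂`-vector. [folklore] -/
def zb (v : Fin n → ZMod 2) : Fin n → Bool := fun i => decide (v i = 1)

/-- `bz ∘ zb = id`. [folklore] -/
@[simp] theorem bz_zb (v : Fin n → ZMod 2) : bz (zb v) = v := by
  funext i; simp only [bz_apply, zb]; exact toZ_decide_eq_one (v i)

/-- `zb ∘ bz = id`. [folklore] -/
@[simp] theorem zb_bz (x : Fin n → Bool) : zb (bz x) = x := by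
  funext i; cases h : x i <;> simp [zb, h, Literature.Computability.Complexity.BLR.toZ]

/-- The equivalence `{0,1}ⁿ ≃ 𝔽₂ⁿ`. [folklore] -/
def bzEquiv : (Fin n → Bool) ≃ (Fin n → ZMod 2) := ⟨bz, zb, zb_bz, bz_zb⟩

/-- The list reading is `bz ∘ toInput`. [folklore] -/
theorem vecZ_eq_bz (l : List Bool) : vecZ n l = bz (toInput n l) := rfl

/-- The sign `(-1)^a ∈ ℝ` of `a ∈ 𝔽₂` (real-valued twin of `PelegShpilkaVolk.sgnZ : ZMod 2 → ℂ` of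
`StabilizerRankLowerBoundsProofs.lean`, not imported here). [folklore] -/
def sgnZ (a : ZMod 2) : ℝ := if a = 0 then 1 else -1

/-- Every element of `𝔽₂` is `0` or `1`. [folklore] -/
theorem zmod2_eq_zero_or_one (a : ZMod 2) : a = 0 ∨ a = 1 := by
  fin_cases a
  · exact Or.inl rfl
  · exact Or.inr rfl

/-- `sgnZ` is a character. [folklore] -/
theorem sgnZ_add (a b : ZMod 2) : sgnZ (a + b) = sgnZ a * sgnZ b := by
  have h10 : (1 : ZMod 2) ≠ 0 := by decide
  have h11 : (1 : ZMod 2) + 1 = 0 := rfl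
  rcases zmod2_eq_zero_or_one a with rfl | rfl <;> rcases zmod2_eq_zero_or_one b with rfl | rfl <;>
    simp [sgnZ, h10, h11]

/-- `sgnZ 0 = 1`. [folklore] -/
@[simp] theorem sgnZ_zero : sgnZ 0 = 1 := rfl

/-- `sgnZ a = 1 ↔ a = 0`. [folklore] -/
theorem sgnZ_eq_one_iff (a : ZMod 2) : sgnZ a = 1 ↔ a = 0 := by
  have h10 : (1 : ZMod 2) ≠ 0 := by decide
  rcases zmod2_eq_zero_or_one a with rfl | rfl
  · simp [sgnZ]
  · simp [sgnZ, h10]; norm_num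

/-- `sgnZ a = -1` when `a ≠ 0`. [folklore] -/
theorem sgnZ_of_ne_zero {a : ZMod 2} (h : a ≠ 0) : sgnZ a = -1 := if_neg h

/-- `signOf b = sgnZ (toZ b)`. [folklore] -/
theorem signOf_eq_sgnZ (b : Bool) : signOf b = sgnZ (toZ b) := by
  cases b <;> simp [signOf, sgnZ, Literature.Computability.Complexity.BLR.toZ]

/-- A sum over `𝔽₂` read as a sign is the product of the signs. [folklore] -/
theorem sgnZ_sum {ι : Type*} (s : Finset ι) (f : ι → ZMod 2) : sgnZ (∑ i ∈ s, f i) = ∏ i ∈ s, sgnZ (f i) := by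
  classical
  induction s using Finset.induction_on with
  | empty => simp
  | insert a s ha ih => rw [sum_insert ha, prod_insert ha, sgnZ_add, ih]

/-- **The twist is the sign of the dot product.** [folklore] -/
theorem twist_eq_sgnZ (x y : Fin n → Bool) : twist x y = sgnZ (dotZ (bz x) (bz y)) := by
  rw [twist, dotZ, sgnZ_sum]
  refine prod_congr rfl fun i _ => ?_
  simp only [bz_apply]
  cases x i <;> cases y i <;> simp [sgnZ, Literature.Computability.Complexity.BLR.toZ]

/-- **Character sum**: `Σ_x (-1)^{v · x} = 2ⁿ [v = 0]` over `𝔽₂ⁿ`. [folklore] -/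
theorem sum_sgnZ_dotZ (v : Fin n → ZMod 2) :
    ∑ x : Fin n → Bool, sgnZ (dotZ v (bz x)) = if v = 0 then (2 : ℝ) ^ n else 0 := by
  have h := BuzetChailloux.sum_twist_left (n := n) (zb v)
  simp_rw [twist_eq_sgnZ, bz_zb, dotZ_comm _ v] at h
  rw [h]
  by_cases hv : v = 0
  · rw [if_pos hv, if_pos]; funext i; simp [zb, BuzetChailloux.zeroVec, hv]
  · rw [if_neg hv, if_neg]; intro h'; apply hv
    rw [← bz_zb v, show zb v = zeroV from h', bz_zeroV]

/-! ### Additive maps on the cube -/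

/-- The unit vector `eᵢ`. [folklore] -/
def ev (i : Fin n) : Fin n → Bool := fun c => decide (c = i)

/-- `bz eᵢ` is the basis vector. [folklore] -/
@[simp] theorem bz_ev (i : Fin n) : bz (ev i) = Pi.single i 1 := by
  funext c; by_cases h : c = i
  · subst h; simp [ev, Literature.Computability.Complexity.BLR.toZ]
  · simp [ev, h, Literature.Computability.Complexity.BLR.toZ]

/-- The restriction of a bit vector to a set of coordinates. [folklore] -/
def restrictTo (A : Finset (Fin n)) (d : Fin n → Bool) : Fin n → Bool := fun j => decide (j ∈ A) && d j

/-- **An additive map is determined by the unit vectors**: `φ(d) = Σ_j [d_j] φ(eⱼ)`. [folklore] -/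
theorem additive_eq_sum (φ : (Fin n → Bool) → ZMod 2) (h0 : φ zeroV = 0)
    (hadd : ∀ x y, φ (xorVec x y) = φ x + φ y) (d : Fin n → Bool) : φ d = ∑ j, toZ (d j) * φ (ev j) := by
  classical
  suffices key : ∀ A : Finset (Fin n), φ (restrictTo A d) = ∑ j ∈ A, toZ (d j) * φ (ev j) by
    have := key univ
    rwa [show restrictTo univ d = d from funext fun j => by simp [restrictTo]] at this
  intro A
  induction A using Finset.induction_on with
  | empty =>
    rw [sum_empty, show restrictTo ∅ d = zeroV from funext fun j => by simp [restrictTo, zeroV], h0]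
  | insert a A ha ih =>
    have e : restrictTo (insert a A) d = xorVec (restrictTo A d) (fun j => decide (j = a) && d a) := by
      funext j
      by_cases hj : j = a
      · subst hj; simp [restrictTo, ha]
      · simp [restrictTo, hj]
    rw [e, hadd, ih, sum_insert ha, add_comm]
    congr 1
    cases hda : d a
    · simp only [Bool.and_false]
      rw [show (fun j : Fin n => false) = zeroV from rfl, h0]
      simp [Literature.Computability.Complexity.BLR.toZ]
    · simp only [Bool.and_true]
      rw [show (fun j : Fin n => decide (j = a)) = ev a from rfl]
      simp [Literature.Computability.Complexity.BLR.toZ]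

/-! ### The oracle and the readings of the machine's data -/

/-- The list oracle of a Boolean function (reads its argument as `n` bits). [folklore] -/
def liftQ (q : (Fin n → Bool) → Bool) : List Bool → Bool := fun v => q (toInput n v)

/-- Reading `zeroL`. [folklore] -/
@[simp] theorem toInput_zeroL : toInput n (zeroL n) = zeroV := by
  funext i; simp [toInput, zeroL, zeroV]

/-- Reading a list built coordinatewise. [folklore] -/
theorem toInput_map_range (g : ℕ → Bool) : toInput n ((List.range n).map g) = fun i : Fin n => g i := by
  funext i
  simp only [toInput]
  rw [List.getD_eq_getElem _ _ (by simp), List.getElem_map, List.getElem_range]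

/-- Reading `unitL`. [folklore] -/
@[simp] theorem toInput_unitL (i : Fin n) : toInput n (unitL n i) = ev i := by
  rw [unitL, toInput_map_range]; funext c; simp [ev, Fin.ext_iff]

/-- Reading `pairL`. [folklore] -/
@[simp] theorem toInput_pairL (i j : Fin n) : toInput n (pairL n i j) = xorVec (ev i) (ev j) := by
  rw [pairL, toInput_map_range]; funext c; simp [ev, Fin.ext_iff]

/-- Reading `bxorL`. [folklore] -/
theorem toInput_bxorL (u v : List Bool) : toInput n (bxorL u v) = xorVec (toInput n u) (toInput n v) := by
  funext i; simp only [toInput, xorVec_apply]; exact getD_bxorL u v i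

/-- Reading `List.ofFn`. [folklore] -/
@[simp] theorem toInput_ofFn (w : Fin n → Bool) : toInput n (List.ofFn w) = w := by
  funext i; simp only [toInput]; rw [List.getD_eq_getElem _ _ (by simp), List.getElem_ofFn]

/-- Reading the empty list. [folklore] -/
@[simp] theorem toInput_nil : toInput n ([] : List Bool) = zeroV := by
  funext i; simp [toInput, zeroV]

section Readings

variable (q : (Fin n → Bool) → Bool)

/-- **The machine's matrix is the polar form**: `[bentry i j] = B_{[q]}(eᵢ, eⱼ)` (also on the
diagonal, where both vanish). [cite: MacWilliamsSloane1977, Ch. 15 §2] -/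
theorem toZ_bentry (i j : Fin n) : toZ (bentry (liftQ q) n i j) = polar (toZFun q) (ev i) (ev j) := by
  unfold bentry liftQ
  by_cases hij : i = j
  · subst hij
    rw [polar_self]
    simp [Literature.Computability.Complexity.BLR.toZ]
  · have : decide ((i : ℕ) = j) = false := by simpa [Fin.ext_iff] using hij
    rw [this]
    simp only [Bool.not_false, Bool.true_and, toZ_xor, toInput_pairL, toInput_unitL, toInput_zeroL, polar, toZFun_apply]
    rw [show (zeroV : Fin n → Bool) = fun _ => false from rfl]
    ring

/-- `pairL` is symmetric. [folklore] -/
theorem pairL_comm (i j : ℕ) : pairL n i j = pairL n j i := by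
  unfold pairL; exact List.map_congr_left fun c _ => Bool.xor_comm _ _

/-- **The matrix is symmetric** (for any oracle). [cite: MacWilliamsSloane1977, Ch. 15 §2] -/
theorem bentry_comm (q' : List Bool → Bool) (i j : ℕ) : bentry q' n i j = bentry q' n j i := by
  unfold bentry
  rw [pairL_comm]
  by_cases h : i = j
  · subst h; rfl
  · have h1 : decide (i = j) = false := by simpa using h
    have h2 : decide (j = i) = false := by simpa using (Ne.symm h)
    rw [h1, h2]
    simp only [Bool.not_false, Bool.true_and]
    cases q' (pairL n j i) <;> cases q' (unitL n i) <;> cases q' (unitL n j) <;> cases q' (zeroL n) <;> rfl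

/-- The rows of the matrix are the `n` rows `i ↦ (bentry i j)_j`. [folklore] -/
theorem mem_bmatOf_iff (q' : List Bool → Bool) (r : List Bool) :
    r ∈ bmatOf q' n ↔ ∃ i, i < n ∧ r = (List.range n).map fun j => bentry q' n i j := by
  simp only [bmatOf, List.mem_map, List.mem_range]
  constructor
  · rintro ⟨i, hi, rfl⟩; exact ⟨i, hi, rfl⟩
  · rintro ⟨i, hi, rfl⟩; exact ⟨i, hi, rfl⟩

/-- The reading of row `i`: `(row i)_j = [bentry i j]`. [folklore] -/
theorem bz_row (q' : List Bool → Bool) (i : ℕ) (j : Fin n) :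
    vecZ n ((List.range n).map fun j => bentry q' n i j) j = toZ (bentry q' n i j) := by
  rw [vecZ_eq_bz, toInput_map_range]; rfl

/-- **Kernel of the matrix = common zeros of the rows.** [folklore] -/
theorem mem_kerSet_bmatOf_iff (q' : List Bool → Bool) (v : Fin n → ZMod 2) :
    v ∈ kerSet n (bmatOf q' n) ↔ ∀ i : Fin n, ∑ j : Fin n, toZ (bentry q' n (i : ℕ) (j : ℕ)) * v j = 0 := by
  constructor
  · intro h i
    have := h _ ((mem_bmatOf_iff q' _).2 ⟨i, i.2, rfl⟩)
    unfold dotZ at this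
    simpa only [bz_row] using this
  · intro h r hr
    obtain ⟨i, hi, rfl⟩ := (mem_bmatOf_iff q' r).1 hr
    unfold dotZ
    simpa only [bz_row] using h ⟨i, hi⟩

variable {q}
variable (hq : toZFun q ∈ lowDeg n 2)
include hq

/-- **The polar form against `d` is the matrix applied to `d`**: `B(eᵢ, d) = Σ_j [bentry i j] [d_j]`.
[cite: MacWilliamsSloane1977, Ch. 15 §2] -/
theorem polar_ev_eq_sum (i : Fin n) (d : Fin n → Bool) :
    polar (toZFun q) (ev i) d = ∑ j : Fin n, toZ (bentry (liftQ q) n (i : ℕ) (j : ℕ)) * toZ (d j) := by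
  have := additive_eq_sum (fun d => polar (toZFun q) (ev i) d) (polar_zero_right _ _)
    (fun x y => polar_add_right hq _ x y) d
  rw [this]
  exact sum_congr rfl fun j _ => by rw [toZ_bentry, mul_comm]

/-- `B(x, d) = Σ_i [x_i] B(eᵢ, d)`. [cite: MacWilliamsSloane1977, Ch. 15 §2] -/
theorem polar_eq_sum (x d : Fin n → Bool) : polar (toZFun q) x d = ∑ i, toZ (x i) * polar (toZFun q) (ev i) d :=
  additive_eq_sum (fun x => polar (toZFun q) x d) (by rw [polar_comm]; exact polar_zero_right _ _)
    (fun x y => polar_add_left hq x y d) x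

omit hq in
/-- The vector `B d` (`i ↦ B(eᵢ, d)`). [folklore] -/
def Bd (q : (Fin n → Bool) → Bool) (d : Fin n → Bool) : Fin n → ZMod 2 := fun i => polar (toZFun q) (ev i) d

/-- `B(x, d) = (B d) · x`. [folklore] -/
theorem polar_eq_dotZ (x d : Fin n → Bool) : polar (toZFun q) x d = dotZ (Bd q d) (bz x) := by
  rw [polar_eq_sum hq, dotZ]
  exact sum_congr rfl fun i _ => by rw [Bd, bz_apply, mul_comm]

/-- `B d` is additive in `d`. [folklore] -/
theorem Bd_xorVec (d d' : Fin n → Bool) : Bd q (xorVec d d') = Bd q d + Bd q d' := by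
  funext i; exact polar_add_right hq _ _ _

omit hq in
/-- `B 0 = 0`. [folklore] -/
@[simp] theorem Bd_zeroV : Bd q (zeroV : Fin n → Bool) = 0 := by
  funext i; exact polar_zero_right _ _

/-- **The radical is the kernel**: `B d = 0 ↔ bz d ∈ ker (bmatOf)`. [cite: MacWilliamsSloane1977, Ch. 15 §2] -/
theorem Bd_eq_zero_iff (d : Fin n → Bool) : Bd q d = 0 ↔ bz d ∈ kerSet n (bmatOf (liftQ q) n) := by
  rw [mem_kerSet_bmatOf_iff]
  constructor
  · intro h i
    have := congrFun h i
    rw [Bd, polar_ev_eq_sum hq] at this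
    exact this
  · intro h
    funext i
    rw [Bd, polar_ev_eq_sum hq]
    exact h i

end Readings

/-! ### Dickson's theorem in support form -/

section Dickson

variable {q : (Fin n → Bool) → Bool} (hq : toZFun q ∈ lowDeg n 2)

/-- The Walsh coefficient `W(u) = Σ_x (-1)^{q(x)} (-1)^{u·x}` of the phase function `(-1)^q`.
[cite: Carlet2020, §5.2] -/
def walsh (q : (Fin n → Bool) → Bool) (u : Fin n → Bool) : ℝ := ∑ x, sgnZ (toZFun q x) * twist u x

/-- The autocorrelation `A(d) = Σ_x (-1)^{q(x) ⊕ q(x ⊕ d)}`. [folklore] -/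
def autoc (q : (Fin n → Bool) → Bool) (d : Fin n → Bool) : ℝ := ∑ x, sgnZ (toZFun q x) * sgnZ (toZFun q (xorVec x d))

/-- The affine functional `ℓ(d) = q(d) ⊕ q(0)`. [folklore] -/
def ell (q : (Fin n → Bool) → Bool) (d : Fin n → Bool) : ZMod 2 := toZFun q d + toZFun q zeroV

/-- The radical of the polar form, as a finset of bit vectors. [cite: MacWilliamsSloane1977, Ch. 15 §2] -/
def rad (q : (Fin n → Bool) → Bool) : Finset (Fin n → Bool) := univ.filter fun d => Bd q d = 0

omit hq in
/-- Membership in the radical. [folklore] -/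
theorem mem_rad {d : Fin n → Bool} : d ∈ rad q ↔ Bd q d = 0 := by simp [rad]

include hq

/-- **Autocorrelation of a quadratic**: `A(d) = (-1)^{ℓ(d)} · 2ⁿ · [d ∈ rad]`.
[cite: MacWilliamsSloane1977, Ch. 15 §2] -/
theorem autoc_eq (d : Fin n → Bool) : autoc q d = sgnZ (ell q d) * (if Bd q d = 0 then (2 : ℝ) ^ n else 0) := by
  unfold autoc
  have e : ∀ x : Fin n → Bool, sgnZ (toZFun q x) * sgnZ (toZFun q (xorVec x d)) =
      sgnZ (ell q d) * sgnZ (dotZ (Bd q d) (bz x)) := by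
    intro x
    rw [← sgnZ_add, ← sgnZ_add, add_comm (toZFun q x), shift_add_eq_polar, polar_eq_dotZ hq]
    unfold ell; congr 1; rw [show (fun _ : Fin n => false) = zeroV from rfl]; ring
  rw [sum_congr rfl fun x _ => e x, ← mul_sum, sum_sgnZ_dotZ]

omit hq in
/-- **Wiener–Khinchin**: `W(u)² = Σ_d (-1)^{u·d} A(d)`. [folklore] -/
theorem walsh_sq (u : Fin n → Bool) : walsh q u ^ 2 = ∑ d, twist u d * autoc q d := by
  rw [walsh, sq, sum_mul_sum]
  have inner : ∀ x : Fin n → Bool, ∑ y, sgnZ (toZFun q x) * twist u x * (sgnZ (toZFun q y) * twist u y) =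
      ∑ d, twist u d * (sgnZ (toZFun q x) * sgnZ (toZFun q (xorVec x d))) := by
    intro x
    rw [← Equiv.sum_comp (BuzetChailloux.bxorPerm x)]
    refine sum_congr rfl fun d _ => ?_
    rw [BuzetChailloux.bxorPerm_apply, show BuzetChailloux.bxor x d = xorVec x d from rfl,
      show xorVec x d = (fun i => x i ^^ d i) from rfl, BuzetChailloux.twist_bxor_right]
    have := Simon.twist_mul_self u x
    linear_combination (sgnZ (toZFun q x) * sgnZ (toZFun q fun i => x i ^^ d i) * twist u d) * this
  rw [sum_congr rfl fun x _ => inner x, sum_comm]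
  refine sum_congr rfl fun d _ => ?_
  rw [autoc, mul_sum]

/-- `W(u)² = 2ⁿ Σ_{d ∈ rad} (-1)^{u·d ⊕ ℓ(d)}`. [cite: MacWilliamsSloane1977, Ch. 15 §2] -/
theorem walsh_sq_eq_sum_rad (u : Fin n → Bool) :
    walsh q u ^ 2 = (2 : ℝ) ^ n * ∑ d ∈ rad q, sgnZ (dotZ (bz u) (bz d) + ell q d) := by
  rw [walsh_sq, rad, sum_filter, mul_sum]
  refine sum_congr rfl fun d _ => ?_
  rw [autoc_eq hq, twist_eq_sgnZ, sgnZ_add]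
  split_ifs <;> ring

/-! #### `ℓ` on the radical is the dot product with `u⋆` -/

/-- `ℓ` is additive along the radical. [folklore] -/
theorem ell_xorVec {d d' : Fin n → Bool} (hd' : Bd q d' = 0) : ell q (xorVec d d') = ell q d + ell q d' := by
  unfold ell
  have h := shift_add_eq_polar (toZFun q) d d'
  rw [polar_eq_dotZ hq, hd', dotZ_zero_left, zero_add, show (fun _ : Fin n => false) = zeroV from rfl] at h
  linear_combination h - toZFun q d * QuadPolar.two_eq_zero

omit hq in
/-- `ℓ(0) = 0`. [folklore] -/
@[simp] theorem ell_zeroV : ell q zeroV = 0 := CharTwo.add_self_eq_zero _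

omit hq in
/-- The machine's matrix of `q`. [folklore] -/
abbrev BMat (q : (Fin n → Bool) → Bool) : List (List Bool) := bmatOf (liftQ q) n

omit hq in
/-- Its reduced echelon form. [folklore] -/
abbrev SRed (q : (Fin n → Bool) → Bool) : List F2Elim.Row := rrun n (bmatOf (liftQ q) n)

omit hq in
/-- The kernel vectors of the reduced form, read as bit vectors. [folklore] -/
def kvecV (q : (Fin n → Bool) → Bool) (f : ℕ) : Fin n → Bool := toInput n (kvec n (rrun n (bmatOf (liftQ q) n)) f)

omit hq in
/-- The support point `u⋆`, read as a bit vector. [folklore] -/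
def ustarV (q : (Fin n → Bool) → Bool) : Fin n → Bool := toInput n (ustarOf (liftQ q) n (rrun n (bmatOf (liftQ q) n)))

omit hq in
/-- Entries of `u⋆`: `0` at pivot columns, `ℓ(kvec f)` at free columns `f`. [folklore] -/
theorem toZ_ustarV (c : Fin n) :
    toZ (ustarV q c) = if isPiv (SRed q) c = true then 0 else ell q (kvecV q c) := by
  unfold ustarV ustarOf
  rw [toInput_map_range]
  simp only
  by_cases hp : isPiv (SRed q) c = true
  · rw [hp, if_pos rfl]; rfl
  · rw [if_neg hp]
    have : isPiv (SRed q) c = false := by simpa using hp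
    rw [this]
    simp only [Bool.not_false, Bool.true_and, toZ_xor, ell, kvecV, liftQ, toInput_zeroL, toZFun_apply]

omit hq in
/-- Entries of the kernel vectors at FREE columns are `[c = f]`. [folklore] -/
theorem kvecV_apply_of_free {c : Fin n} (hc : isPiv (SRed q) c = false) (f : ℕ) : kvecV q f c = decide ((c : ℕ) = f) := by
  unfold kvecV toInput
  rw [getD_kvec c.2, pe_of_not_isPiv hc, Bool.or_false]

/-- The kernel vectors lie in the radical. [cite: KnuthTAOCP2, §4.6.2 Algorithm N] -/
theorem Bd_kvecV {f : Fin n} (hf : isPiv (SRed q) f = false) : Bd q (kvecV q f) = 0 := by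
  rw [Bd_eq_zero_iff hq, kvecV, ← vecZ_eq_bz]
  exact vecZ_kvec_mem_kerSet hf

omit hq in
/-- **On the kernel vectors, `u⋆ · kvec f = ℓ(kvec f)`.** [folklore] -/
theorem dot_ustar_kvecV {f : Fin n} (hf : isPiv (SRed q) f = false) :
    dotZ (bz (ustarV q)) (bz (kvecV q f)) = ell q (kvecV q f) := by
  unfold dotZ
  rw [sum_eq_single f]
  · rw [bz_apply, bz_apply, toZ_ustarV, if_neg (by rw [hf]; decide), kvecV_apply_of_free hf]
    simp [Literature.Computability.Complexity.BLR.toZ]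
  · intro c _ hcf
    rw [bz_apply, bz_apply, toZ_ustarV]
    by_cases hp : isPiv (SRed q) c = true
    · rw [if_pos hp, zero_mul]
    · rw [kvecV_apply_of_free (by simpa using hp)]
      have : decide ((c : ℕ) = f) = false := by simpa [Fin.ext_iff] using hcf
      rw [this]; simp [Literature.Computability.Complexity.BLR.toZ]
  · intro h; exact absurd (mem_univ f) h

/-- Partial sums of the kernel decomposition of a radical vector, as bit vectors. [folklore] -/
def psum (q : (Fin n → Bool) → Bool) (d : Fin n → Bool) (A : Finset (Fin n)) : Fin n → Bool :=
  zb (∑ f ∈ A, toZ (d f) • bz (kvecV q f))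

omit hq in
/-- `bz` of the partial sums. [folklore] -/
theorem bz_psum (d : Fin n → Bool) (A : Finset (Fin n)) : bz (psum q d A) = ∑ f ∈ A, toZ (d f) • bz (kvecV q f) := by
  rw [psum, bz_zb]

omit hq in
/-- The partial sums grow by one kernel vector at a time. [folklore] -/
theorem psum_insert (d : Fin n → Bool) {A : Finset (Fin n)} {a : Fin n} (ha : a ∉ A) :
    psum q d (insert a A) = xorVec (psum q d A) (if d a then kvecV q a else zeroV) := by
  apply bz_injective
  rw [bz_psum, bz_xorVec, bz_psum, sum_insert ha, add_comm]
  congr 1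
  cases d a <;> simp [Literature.Computability.Complexity.BLR.toZ]

/-- The partial sums over free columns stay in the radical. [folklore] -/
theorem Bd_psum (d : Fin n → Bool) {A : Finset (Fin n)} (hA : ∀ f ∈ A, isPiv (SRed q) f = false) : Bd q (psum q d A) = 0 := by
  classical
  induction A using Finset.induction_on with
  | empty =>
    have : psum q d ∅ = zeroV := by apply bz_injective; rw [bz_psum, sum_empty, bz_zeroV]
    rw [this, Bd_zeroV]
  | insert a A ha ih =>
    rw [psum_insert d ha, Bd_xorVec hq, ih fun f hf => hA f (mem_insert_of_mem hf)]
    cases d a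
    · simp
    · simp only [if_true, zero_add]; exact Bd_kvecV hq (hA a (mem_insert_self a A))

/-- **On the radical, `ℓ(d) = u⋆ · d`.** [cite: MacWilliamsSloane1977, Ch. 15 §2] -/
theorem ell_eq_dot_ustar {d : Fin n → Bool} (hd : Bd q d = 0) : ell q d = dotZ (bz (ustarV q)) (bz d) := by
  classical
  -- `d` is the full partial sum over the free columns (K2)
  have hK : bz d ∈ kerSet n (BMat q) := (Bd_eq_zero_iff hq d).1 hd
  have hdec := eq_sum_kvec_of_mem_kerSet hK
  have hfull : d = psum q d (frees n (SRed q)) := by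
    apply bz_injective
    rw [bz_psum]
    conv_lhs => rw [hdec]
    rfl
  -- both sides are additive along the radical and agree on the kernel vectors: induct on the partial sums
  suffices key : ∀ A : Finset (Fin n), (∀ f ∈ A, isPiv (SRed q) f = false) →
      ell q (psum q d A) = dotZ (bz (ustarV q)) (bz (psum q d A)) by
    rw [hfull]; exact key _ fun f hf => mem_frees.1 hf
  intro A hA
  induction A using Finset.induction_on with
  | empty =>
    have : psum q d ∅ = zeroV := by apply bz_injective; rw [bz_psum, sum_empty, bz_zeroV]
    rw [this, ell_zeroV, bz_zeroV, dotZ, ]; simp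
  | insert a A ha ih =>
    have hA' : ∀ f ∈ A, isPiv (SRed q) f = false := fun f hf => hA f (mem_insert_of_mem hf)
    have haf : isPiv (SRed q) a = false := hA a (mem_insert_self a A)
    rw [psum_insert d ha]
    cases d a
    · simp only [Bool.false_eq_true, if_false]
      rw [show xorVec (psum q d A) zeroV = psum q d A from funext fun i => by simp [zeroV]]
      exact ih hA'
    · simp only [if_true]
      rw [ell_xorVec hq (Bd_kvecV hq haf), bz_xorVec, dotZ_add_right, ih hA', dot_ustar_kvecV haf]

/-! #### The character sum over the radical, and Dickson's theorem -/

omit hq in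
/-- Translation by a radical vector permutes the radical. [folklore] -/
theorem xorVec_mem_rad_iff (hq : toZFun q ∈ lowDeg n 2) {d₀ : Fin n → Bool} (h₀ : d₀ ∈ rad q) (d : Fin n → Bool) :
    xorVec d d₀ ∈ rad q ↔ d ∈ rad q := by
  rw [mem_rad, mem_rad, Bd_xorVec hq, mem_rad.1 h₀, add_zero]

omit hq in
/-- `(d ⊕ d₀) ⊕ d₀ = d`. [folklore] -/
theorem xorVec_xorVec_right (d d₀ : Fin n → Bool) : xorVec (xorVec d d₀) d₀ = d := by
  funext i; simp

/-- **Character sums over the radical**: `Σ_{d ∈ rad} (-1)^{v·d} = |rad| · [v ⊥ rad]`. [folklore] -/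
theorem sum_rad_sgnZ (v : Fin n → ZMod 2) :
    ∑ d ∈ rad q, sgnZ (dotZ v (bz d)) = if ∀ d ∈ rad q, dotZ v (bz d) = 0 then ((rad q).card : ℝ) else 0 := by
  classical
  split_ifs with h
  · rw [Finset.card_eq_sum_ones, Nat.cast_sum, Nat.cast_one]
    exact sum_congr rfl fun d hd => by rw [h d hd, sgnZ_zero]
  · push Not at h
    obtain ⟨d₀, hd₀, hne⟩ := h
    -- translating by `d₀` permutes the radical and flips every sign
    have h1 : ∑ d ∈ rad q, sgnZ (dotZ v (bz d)) = ∑ d ∈ rad q, sgnZ (dotZ v (bz (xorVec d d₀))) := by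
      refine Finset.sum_nbij' (fun d => xorVec d d₀) (fun d => xorVec d d₀) ?_ ?_ ?_ ?_ ?_
      · intro d hd; exact (xorVec_mem_rad_iff hq hd₀ d).2 hd
      · intro d hd; exact (xorVec_mem_rad_iff hq hd₀ d).2 hd
      · intro d _; exact xorVec_xorVec_right d d₀
      · intro d _; exact xorVec_xorVec_right d d₀
      · intro d _; rw [xorVec_xorVec_right]
    have h2 : ∀ d, sgnZ (dotZ v (bz (xorVec d d₀))) = -sgnZ (dotZ v (bz d)) := fun d => by
      rw [bz_xorVec, dotZ_add_right, sgnZ_add, sgnZ_of_ne_zero hne]; ring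
    have h3 : ∑ d ∈ rad q, sgnZ (dotZ v (bz d)) = -∑ d ∈ rad q, sgnZ (dotZ v (bz d)) := by
      conv_lhs => rw [h1]
      rw [sum_congr rfl fun d _ => h2 d, sum_neg_distrib]
    linarith

/-- **Dickson's theorem, support form.** For a quadratic `q`,
`W(u)² = 2ⁿ · |rad| · [u ⊕ u⋆ ⊥ rad]`: the Walsh support is the flat `u⋆ ⊕ rad^⊥` and the
squared amplitude on it is `2ⁿ |rad|`. [cite: MacWilliamsSloane1977, Ch. 15 §2 Thm 5] -/
theorem walsh_sq_eq (u : Fin n → Bool) :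
    walsh q u ^ 2 = (2 : ℝ) ^ n *
      (if ∀ d ∈ rad q, dotZ (bz u + bz (ustarV q)) (bz d) = 0 then ((rad q).card : ℝ) else 0) := by
  rw [walsh_sq_eq_sum_rad hq, ← sum_rad_sgnZ hq]
  congr 1
  refine sum_congr rfl fun d hd => ?_
  rw [ell_eq_dot_ustar hq (mem_rad.1 hd), dotZ_add_left]

end Dickson

/-! ### The sampler: reading `uOf`, and the fiber count -/

section Fibers

variable {q : (Fin n → Bool) → Bool} (hq : toZFun q ∈ lowDeg n 2)
include hq


omit hq in
/-- Row `j` of the matrix, as a bit vector. [folklore] -/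
def rowV (q : (Fin n → Bool) → Bool) (j : ℕ) : Fin n → Bool := toInput n ((List.range n).map fun c => bentry (liftQ q) n j c)

omit hq in
/-- Entries of `rowV`. [folklore] -/
theorem bz_rowV (j : ℕ) (c : Fin n) : bz (rowV q j) c = toZ (bentry (liftQ q) n j c) := by
  rw [rowV, ← vecZ_eq_bz, bz_row]

omit hq in
/-- The selected-and-xored rows, as a bit vector. [folklore] -/
def xsV (q : (Fin n → Bool) → Bool) (w : Fin n → Bool) : Fin n → Bool := toInput n (xorSel n (bmatOf (liftQ q) n) (List.ofFn w))

omit hq in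
/-- **The sampled frequency, as a bit vector**: `u(w) = u⋆ ⊕ ⊕_{j : w_j} row_j`. [folklore] -/
def uV (q : (Fin n → Bool) → Bool) (w : Fin n → Bool) : Fin n → Bool := toInput n (uOf (liftQ q) n (List.ofFn w))

omit hq in
/-- `u(w) = u⋆ ⊕ xs(w)`. [folklore] -/
theorem uV_eq (w : Fin n → Bool) : uV q w = xorVec (ustarV q) (xsV q w) := by
  rw [uV, uOf, toInput_bxorL]; rfl

omit hq in
/-- Reading a fold of `bxorL`. [folklore] -/
theorem vecZ_foldl_bxorL (L : List (List Bool)) (acc : List Bool) :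
    vecZ n (L.foldl bxorL acc) = vecZ n acc + (L.map (vecZ n)).sum := by
  induction L generalizing acc with
  | nil => simp
  | cons r L ih => rw [List.foldl_cons, ih, vecZ_bxorL, List.map_cons, List.sum_cons, add_assoc]

omit hq in
/-- `zipWith` of a `range`-indexed list with `List.ofFn`. [folklore] -/
theorem zipWith_map_range_ofFn {α β γ : Type*} (f : α → β → γ) (g : ℕ → α) (w : Fin n → β) :
    List.zipWith f ((List.range n).map g) (List.ofFn w) = List.ofFn fun j : Fin n => f (g j) (w j) := by
  apply List.ext_getElem
  · simp
  · intro k h1 h2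
    rw [List.getElem_zipWith, List.getElem_map, List.getElem_range, List.getElem_ofFn, List.getElem_ofFn]

omit hq in
/-- The empty list reads as `0`. [folklore] -/
@[simp] theorem vecZ_nil : vecZ n ([] : List Bool) = 0 := by
  funext i; simp [vecZ, Literature.Computability.Complexity.BLR.toZ]

omit hq in
/-- **Reading `xorSel`**: `bz (xs w) = Σ_j [w_j] · row_j`. [folklore] -/
theorem bz_xsV (w : Fin n → Bool) : bz (xsV q w) = ∑ j, toZ (w j) • bz (rowV q j) := by
  rw [xsV, ← vecZ_eq_bz, xorSel, vecZ_foldl_bxorL, bmatOf, zipWith_map_range_ofFn, List.map_ofFn, List.sum_ofFn]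
  rw [show vecZ n (zeroL n) = 0 from by rw [vecZ_eq_bz, toInput_zeroL, bz_zeroV], zero_add]
  refine sum_congr rfl fun j _ => ?_
  simp only [Function.comp_apply]
  cases w j
  · simp [Literature.Computability.Complexity.BLR.toZ]
  · simp only [if_true]
    rw [rowV, ← vecZ_eq_bz]
    simp [Literature.Computability.Complexity.BLR.toZ]

omit hq in
/-- The row-combination map `v ↦ Σ_j v_j · row_j`. [folklore] -/
def rowComb (q : (Fin n → Bool) → Bool) : (Fin n → ZMod 2) →ₗ[ZMod 2] (Fin n → ZMod 2) where
  toFun v := ∑ j, v j • bz (rowV q j)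
  map_add' v v' := by simp only [Pi.add_apply, add_smul, sum_add_distrib]
  map_smul' a v := by simp only [Pi.smul_apply, smul_eq_mul, RingHom.id_apply, smul_sum, smul_smul]

omit hq in
/-- Unfolding `rowComb`. [folklore] -/
theorem rowComb_apply (v : Fin n → ZMod 2) : rowComb q v = ∑ j, v j • bz (rowV q j) := rfl

omit hq in
/-- **The kernel of the row-combination map is the kernel of the matrix** (the matrix is
symmetric). [folklore] -/
theorem rowComb_eq_zero_iff (v : Fin n → ZMod 2) : rowComb q v = 0 ↔ v ∈ kerSet n (BMat q) := by
  rw [mem_kerSet_bmatOf_iff]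
  have e : ∀ i : Fin n, rowComb q v i = ∑ j : Fin n, toZ (bentry (liftQ q) n i j) * v j := by
    intro i
    rw [rowComb_apply, Finset.sum_apply]
    refine sum_congr rfl fun j _ => ?_
    rw [Pi.smul_apply, smul_eq_mul, bz_rowV, bentry_comm, mul_comm]
  constructor
  · intro h i; rw [← e, h]; rfl
  · intro h; funext i; rw [e, h i]; rfl

omit hq in
/-- The matrix has `n` rows. [folklore] -/
theorem length_bmatOf (q' : List Bool → Bool) : (bmatOf q' n).length = n := by simp [bmatOf]

omit hq in
/-- Rows of the matrix by index. [folklore] -/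
theorem bmatOf_getElem (q' : List Bool → Bool) (k : ℕ) (hk : k < (bmatOf q' n).length) :
    (bmatOf q' n)[k] = (List.range n).map fun j => bentry q' n k j := by
  simp [bmatOf]

omit hq in
/-- **The range of the row-combination map is the row span.** [folklore] -/
theorem exists_rowComb_eq_iff (t : Fin n → ZMod 2) : (∃ v, rowComb q v = t) ↔ t ∈ rowSpan n (BMat q) := by
  have hrow : ∀ k : Fin (bmatOf (liftQ q) n).length, vecZ n (bmatOf (liftQ q) n)[k] = bz (rowV q k) := by
    intro k
    rw [rowV, ← vecZ_eq_bz, Fin.getElem_fin, bmatOf_getElem _ _ k.2]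
  constructor
  · rintro ⟨v, rfl⟩
    rw [rowComb_apply]
    refine Submodule.sum_mem _ fun j _ => Submodule.smul_mem _ _ (vecZ_mem_rowSpan ?_)
    exact (mem_bmatOf_iff _ _).2 ⟨j, j.2, rfl⟩
  · intro ht
    obtain ⟨c, hc⟩ := exists_fun_of_mem_rowSpan ht
    refine ⟨fun j => c (Fin.cast (length_bmatOf _).symm j), ?_⟩
    rw [hc, rowComb_apply]
    symm
    refine Fintype.sum_equiv (finCongr (length_bmatOf (liftQ q))) _ _ fun k => ?_
    rw [hrow k]
    simp [finCongr]

omit hq in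
/-- The fiber over `u`, in `𝔽₂`-coordinates: `u(w) = u ↔ rowComb (bz w) = bz u + bz u⋆`. [folklore] -/
theorem uV_eq_iff (w u : Fin n → Bool) : uV q w = u ↔ rowComb q (bz w) = bz u + bz (ustarV q) := by
  rw [uV_eq, rowComb_apply]
  simp only [bz_apply]
  rw [← bz_xsV]
  constructor
  · intro h
    have := congrArg bz h
    rw [bz_xorVec] at this
    rw [← this]
    funext i
    simp only [Pi.add_apply]
    rw [add_comm (bz (ustarV q) i) (bz (xsV q w) i), add_assoc, CharTwo.add_self_eq_zero, add_zero]
  · intro h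
    apply bz_injective
    rw [bz_xorVec, h]
    funext i
    simp only [Pi.add_apply]
    rw [add_comm (bz u i), ← add_assoc, CharTwo.add_self_eq_zero, zero_add]

omit hq in
/-- Counting solutions of an affine equation for a linear map: `|ker|` if solvable, else `0`. [folklore] -/
theorem card_filter_rowComb_eq (t : Fin n → ZMod 2) :
    (univ.filter fun v : Fin n → ZMod 2 => rowComb q v = t).card =
      if ∃ v₀, rowComb q v₀ = t then (univ.filter fun v : Fin n → ZMod 2 => rowComb q v = 0).card else 0 := by
  classical
  split_ifs with h
  · obtain ⟨v₀, hv₀⟩ := h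
    -- translation by `v₀` is a bijection from the kernel onto the fiber
    refine Finset.card_nbij' (fun v => v - v₀) (fun v => v + v₀) ?_ ?_ ?_ ?_
    · intro v hv
      simp only [coe_filter, mem_univ, true_and, Set.mem_setOf_eq] at hv ⊢
      rw [map_sub, hv, hv₀, sub_self]
    · intro v hv
      simp only [coe_filter, mem_univ, true_and, Set.mem_setOf_eq] at hv ⊢
      rw [map_add, hv, hv₀, zero_add]
    · intro v _; simp
    · intro v _; simp
  · rw [Finset.card_eq_zero, filter_eq_empty_iff]
    intro v _ hv
    exact h ⟨v, hv⟩

/-- The kernel, counted in `𝔽₂ⁿ`, has the size of the radical. [folklore] -/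
theorem card_filter_rowComb_zero :
    (univ.filter fun v : Fin n → ZMod 2 => rowComb q v = 0).card = (rad q).card := by
  classical
  symm
  refine Finset.card_nbij' bz zb ?_ ?_ ?_ ?_
  · intro d hd
    simp only [coe_filter, mem_univ, true_and, Set.mem_setOf_eq, mem_coe] at hd ⊢
    rw [mem_rad] at hd
    exact (rowComb_eq_zero_iff _).2 ((Bd_eq_zero_iff hq d).1 hd)
  · intro v hv
    simp only [coe_filter, mem_univ, true_and, Set.mem_setOf_eq, mem_coe] at hv ⊢
    rw [mem_rad, Bd_eq_zero_iff hq, bz_zb]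
    exact (rowComb_eq_zero_iff _).1 hv
  · intro d _; exact zb_bz d
  · intro v _; exact bz_zb v

/-- Solvability of the fiber equation is orthogonality to the radical (K3). [folklore] -/
theorem exists_rowComb_iff_orth (t : Fin n → ZMod 2) :
    (∃ v₀, rowComb q v₀ = t) ↔ ∀ d ∈ rad q, dotZ t (bz d) = 0 := by
  rw [exists_rowComb_eq_iff]
  constructor
  · intro ht d hd
    exact dotZ_eq_zero_of_mem_rowSpan ht ((Bd_eq_zero_iff hq d).1 (mem_rad.1 hd))
  · intro h
    refine mem_rowSpan_of_orth_kerSet fun v hv => ?_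
    have := h (zb v) (by rw [mem_rad, Bd_eq_zero_iff hq, bz_zb]; exact hv)
    rwa [bz_zb] at this

/-- **The fiber count**: `#{w : u(w) = u} = |rad| · [bz u + bz u⋆ ⊥ rad]`. [cite: MacWilliamsSloane1977, Ch. 15 §2] -/
theorem card_fiber_eq (u : Fin n → Bool) :
    ((univ.filter fun w : Fin n → Bool => uV q w = u).card : ℝ) =
      if ∀ d ∈ rad q, dotZ (bz u + bz (ustarV q)) (bz d) = 0 then ((rad q).card : ℝ) else 0 := by
  classical
  have e1 : (univ.filter fun w : Fin n → Bool => uV q w = u).card =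
      (univ.filter fun v : Fin n → ZMod 2 => rowComb q v = bz u + bz (ustarV q)).card := by
    refine Finset.card_nbij' bz zb ?_ ?_ ?_ ?_
    · intro w hw
      simp only [coe_filter, mem_univ, true_and, Set.mem_setOf_eq] at hw ⊢
      exact (uV_eq_iff w u).1 hw
    · intro v hv
      simp only [coe_filter, mem_univ, true_and, Set.mem_setOf_eq] at hv ⊢
      refine (uV_eq_iff _ u).2 ?_
      rw [bz_zb]; exact hv
    · intro w _; exact zb_bz w
    · intro v _; exact bz_zb v
  rw [e1, card_filter_rowComb_eq, card_filter_rowComb_zero hq]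
  by_cases h : ∀ d ∈ rad q, dotZ (bz u + bz (ustarV q)) (bz d) = 0
  · rw [if_pos ((exists_rowComb_iff_orth hq _).2 h), if_pos h]
  · rw [if_neg (fun h' => h ((exists_rowComb_iff_orth hq _).1 h')), if_neg h, Nat.cast_zero]

/-- **The sampler is exact.** For a quadratic `q`, the number of coin vectors `w ∈ {0,1}ⁿ` that the
sampler maps to `u`, times `2ⁿ`, is the squared Walsh coefficient `W(u)²`: a uniformly random `w`
yields `u` with probability `W(u)² / 4ⁿ`. [cite: MacWilliamsSloane1977, Ch. 15 §2 Thm 5] -/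
theorem card_fiber_mul_two_pow_eq_walsh_sq (u : Fin n → Bool) :
    ((univ.filter fun w : Fin n → Bool => uV q w = u).card : ℝ) * 2 ^ n = walsh q u ^ 2 := by
  rw [card_fiber_eq hq, walsh_sq_eq hq, mul_comm]

/-- **Pushforward form**: for every `F`, `Σ_w F(u(w)) · 2ⁿ = Σ_u W(u)² F(u)`. [folklore] -/
theorem sum_comp_uV_mul_two_pow (F : (Fin n → Bool) → ℝ) :
    (∑ w : Fin n → Bool, F (uV q w)) * 2 ^ n = ∑ u, walsh q u ^ 2 * F u := by
  classical
  have e : ∑ w : Fin n → Bool, F (uV q w) = ∑ u, ((univ.filter fun w : Fin n → Bool => uV q w = u).card : ℝ) * F u := by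
    rw [← Finset.sum_fiberwise univ (fun w => uV q w) (fun w => F (uV q w))]
    refine sum_congr rfl fun u _ => ?_
    rw [sum_congr rfl fun w hw => by rw [(mem_filter.1 hw).2], sum_const, nsmul_eq_mul]
  rw [e, sum_mul]
  exact sum_congr rfl fun u _ => by rw [mul_right_comm, card_fiber_mul_two_pow_eq_walsh_sq hq]

end Fibers

end QuadSampler

end Literature.Computability.QuantumComplexity

end
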